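import Summits.NavierStokesRegularity.NavierStokesRegularity.Theorems.TypeITraceScarL3.Negative.SwirlWitness
import Summits.NavierStokesRegularity.NavierStokesRegularity.Theorems.TypeITraceScarL3.Negative.StubCSpreadWitnessTypeI
import HarnessLib

/-!
# The travelling swirl, part 2: clause (G) and the Type-I bookkeeping (I) along an arbitrary path

Negative-lane lemma file of the disprover seat `cdisprove-stmt-NavierStokesRegularity-18385`
(`--supports` the item).  For the travelling swirl `U(t, x) = S(t, x − c(t))` of part 1 along a path
`c` that is `C¹` on `t < 0`: pointwise facts of the travelling copy, the weak spatial gradient on every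
`Q(a)` (clause (G)), the indicator bounds `|U|² ≤ (−t)⁻¹𝟙_B`, `|U|³ ≤ (−t)^{−3/2}𝟙_B`,
`|∇U|² ≤ 48L'²(−t)⁻²𝟙_B` on `B = B(c(t), 2√(−t))`, and hence — via the generic slice lemmas of
`StubCSpreadWitnessTypeI` — `A, C ≤ 8|B₁|`, `E ≤ 768 L'²|B₁|` on every parabolic cylinder below
`t = 0` and ONE `M` with `𝐈(Q(a)) ≤ M` for all `a` (clause (I), pressure `0`).  Not a Navier–Stokes
solution; NS regularity is neither proved nor refuted here. [folklore; AlbrittonBarker2019 §1]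
-/


noncomputable section

set_option linter.dupNamespace false

namespace Summit.NavierStokesRegularity.NavierStokesRegularity.Theorems.TypeITraceScarL3.Negative

open MeasureTheory Set Function Filter Topology Metric TopologicalSpace
open Literature.Analysis.FluidPDE Literature.Analysis.FluidPDE.ParabolicBump
open scoped NNReal ENNReal InnerProductSpace RealInnerProductSpace

/-! ### The travelling swirl along a centre path -/

/-- Value at `c(t) + y`. [folklore] -/
theorem swirlTravel_centre_add (c : ℝ → EuclideanSpace ℝ (Fin 3)) (t : ℝ)
    (y : EuclideanSpace ℝ (Fin 3)) : swirlTravel c t (c t + y) = swirlVelocity t y := by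
  simp [swirlTravel]

/-- **The rate** `‖U(t, x)‖ ≤ 1/√(−t)`. [folklore] -/
theorem norm_swirlTravel_le (c : ℝ → EuclideanSpace ℝ (Fin 3)) {t : ℝ} (ht : t < 0)
    (x : EuclideanSpace ℝ (Fin 3)) : ‖swirlTravel c t x‖ ≤ 1 / Real.sqrt (-t) :=
  norm_swirlVelocity_le ht _

/-- Off the ball `B(c(t), 2√(−t))` the field vanishes. [folklore] -/
theorem swirlTravel_eq_zero_of (c : ℝ → EuclideanSpace ℝ (Fin 3)) {t : ℝ} (ht : t < 0)
    {x : EuclideanSpace ℝ (Fin 3)} (hx : 2 * Real.sqrt (-t) ≤ ‖x - c t‖) : swirlTravel c t x = 0 :=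
  swirlVelocity_eq_zero_of ht hx

/-- **The peak value** `‖U(t, c(t) + √(−t)e₀)‖ = 1/(2√(−t))`. [folklore] -/
theorem norm_swirlTravel_peak (c : ℝ → EuclideanSpace ℝ (Fin 3)) {t : ℝ} (ht : t < 0) :
    ‖swirlTravel c t (c t + Real.sqrt (-t) • parasiticDir)‖ = 1 / (2 * Real.sqrt (-t)) := by
  rw [swirlTravel_centre_add]; exact norm_swirlVelocity_peak ht

/-- `|U(t, y)| ≤ (−t)^{−1/2} 𝟙_{B(c(t), 2√(−t))}(y)`. [folklore] -/
theorem norm_swirlTravel_le_indicator (c : ℝ → EuclideanSpace ℝ (Fin 3)) {t : ℝ} (ht : t < 0)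
    (y : EuclideanSpace ℝ (Fin 3)) :
    ‖swirlTravel c t y‖ ≤ 1 / Real.sqrt (-t) *
      (ball (c t) (2 * Real.sqrt (-t))).indicator (fun _ => (1 : ℝ)) y := by
  by_cases hy : y ∈ ball (c t) (2 * Real.sqrt (-t))
  · rw [indicator_of_mem hy, mul_one]; exact norm_swirlTravel_le c ht y
  · rw [indicator_of_notMem hy, mul_zero]
    have hy' : 2 * Real.sqrt (-t) ≤ ‖y - c t‖ := by
      rw [mem_ball_iff_norm, not_lt] at hy; exact hy
    rw [swirlTravel_eq_zero_of c ht hy', norm_zero]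

/-- Chain rule for the travelling swirl. [folklore] -/
theorem hasFDerivAt_swirlTravel (c : ℝ → EuclideanSpace ℝ (Fin 3)) (t : ℝ)
    (x : EuclideanSpace ℝ (Fin 3)) :
    HasFDerivAt (swirlTravel c t) (swirlTravelGradient c t x) x := by
  have h1 : HasFDerivAt (swirlVelocity t) (swirlGradient t (x - c t)) (x - c t) :=
    hasFDerivAt_swirlVelocity t _
  have h2 : HasFDerivAt (fun y : EuclideanSpace ℝ (Fin 3) => y - c t)
      (ContinuousLinearMap.id ℝ _) x := (hasFDerivAt_id x).sub_const _
  have h3 := h1.comp x h2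
  rw [ContinuousLinearMap.comp_id] at h3
  exact h3

/-- Hence `fderiv (U t) = ∇U`. [folklore] -/
theorem fderiv_swirlTravel (c : ℝ → EuclideanSpace ℝ (Fin 3)) (t : ℝ) (x : EuclideanSpace ℝ (Fin 3)) :
    fderiv ℝ (swirlTravel c t) x = swirlTravelGradient c t x :=
  (hasFDerivAt_swirlTravel c t x).fderiv

/-- Every time slice of the travelling swirl is smooth. [folklore] -/
theorem contDiff_swirlTravel_slice {n : ℕ∞} (c : ℝ → EuclideanSpace ℝ (Fin 3)) (t : ℝ) :
    ContDiff ℝ n (swirlTravel c t) :=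
  (contDiff_swirlVelocity_slice t).comp (contDiff_id.sub contDiff_const)

/-- Every time slice is continuous. [folklore] -/
theorem continuous_swirlTravel_slice (c : ℝ → EuclideanSpace ℝ (Fin 3)) (t : ℝ) :
    Continuous (swirlTravel c t) :=
  (contDiff_swirlTravel_slice (n := 0) c t).continuous

/-- **`div U(t, ·) = 0` classically**, for every `t` and every path. [folklore] -/
theorem divergence_swirlTravel (c : ℝ → EuclideanSpace ℝ (Fin 3)) (t : ℝ)
    (x : EuclideanSpace ℝ (Fin 3)) : VectorCalculus.divergence (swirlTravel c t) x = 0 := by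
  have h := divergence_swirlVelocity t (x - c t)
  unfold VectorCalculus.divergence at h ⊢
  rw [fderiv_swirlTravel, swirlTravelGradient, ← fderiv_swirlVelocity]
  exact h

/-- **The vorticity at the moving centre**: `(curl U(t, ·))(c(t)) · e₂ = (−t)⁻¹ ≠ 0`. [folklore] -/
theorem curl_swirlTravel_centre_apply_two (c : ℝ → EuclideanSpace ℝ (Fin 3)) {t : ℝ} (ht : t < 0) :
    curl (swirlTravel c t) (c t) 2 = (-t)⁻¹ := by
  have h := curl_swirlVelocity_zero_apply_two ht
  have hD : fderiv ℝ (swirlTravel c t) (c t) = fderiv ℝ (swirlVelocity t) 0 := by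
    rw [fderiv_swirlTravel, swirlTravelGradient, sub_self, fderiv_swirlVelocity]
  simp only [curl] at h ⊢
  rw [hD]
  exact h

/-- Hence the vorticity does not vanish at the moving centre. [folklore] -/
theorem curl_swirlTravel_centre_ne_zero (c : ℝ → EuclideanSpace ℝ (Fin 3)) {t : ℝ} (ht : t < 0) :
    curl (swirlTravel c t) (c t) ≠ 0 := by
  intro h
  have h2 := curl_swirlTravel_centre_apply_two c ht
  rw [h] at h2
  have : (-t)⁻¹ = 0 := by simpa using h2.symm
  exact (inv_pos.2 (by linarith : 0 < -t)).ne' this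

/-- The travelling swirl is smooth on the open slab when the path is smooth on `t < 0`. [folklore] -/
theorem contDiffOn_swirlTravel {n : ℕ∞} {c : ℝ → EuclideanSpace ℝ (Fin 3)}
    (hc : ContDiffOn ℝ n c (Iio 0)) :
    ContDiffOn ℝ n (uncurry (swirlTravel c)) (Iio 0 ×ˢ (univ : Set (EuclideanSpace ℝ (Fin 3)))) := by
  have hshift : ContDiffOn ℝ n (fun p : ℝ × EuclideanSpace ℝ (Fin 3) => (p.1, p.2 - c p.1))
      (Iio 0 ×ˢ univ) :=
    contDiffOn_fst.prodMk (contDiffOn_snd.sub (hc.comp contDiffOn_fst fun p hp => hp.1))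
  have e : uncurry (swirlTravel c) =
      uncurry swirlVelocity ∘ fun p : ℝ × EuclideanSpace ℝ (Fin 3) => (p.1, p.2 - c p.1) := by
    funext p; rfl
  rw [e]
  exact contDiffOn_swirlVelocity.comp hshift fun p hp => ⟨hp.1, mem_univ _⟩

/-- **(G)** the classical gradient is a weak spatial gradient on every `Q(a)` at the origin. [folklore] -/
theorem swirlTravel_hasWeakSpatialGradientOn {c : ℝ → EuclideanSpace ℝ (Fin 3)}
    (hc : ContDiffOn ℝ 1 c (Iio 0)) (a : ℝ) :
    HasWeakSpatialGradientOn (parabolicCylinderOpens a (0 : ℝ × EuclideanSpace ℝ (Fin 3)))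
      (swirlTravel c) (swirlTravelGradient c) := by
  have hQ : ((parabolicCylinderOpens a (0 : ℝ × EuclideanSpace ℝ (Fin 3)) :
      Opens (ℝ × EuclideanSpace ℝ (Fin 3))) : Set (ℝ × EuclideanSpace ℝ (Fin 3))) ⊆ Iio 0 ×ˢ univ := by
    rw [coe_parabolicCylinderOpens]; exact parabolicCylinder_subset_slab a
  have h := hasWeakSpatialGradientOn_of_contDiffOn (S := Iio 0) isOpen_Iio hQ
    (contDiffOn_swirlTravel (n := 1) hc)
  have e : (fun t x => fderiv ℝ (swirlTravel c t) x) = swirlTravelGradient c := by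
    funext t x; exact fderiv_swirlTravel c t x
  rw [e] at h
  exact h

/-! ### Pointwise indicator bounds for the Type-I bookkeeping -/

/-- `|U(t)|² ≤ (−t)⁻¹ 𝟙_{B(c(t), 2√(−t))}`. [folklore] -/
theorem enorm_sq_swirlTravel_le (c : ℝ → EuclideanSpace ℝ (Fin 3)) {t : ℝ} (ht : t < 0)
    (x : EuclideanSpace ℝ (Fin 3)) :
    ‖swirlTravel c t x‖ₑ ^ 2 ≤
      (ball (c t) (2 * Real.sqrt (-t))).indicator (fun _ => ENNReal.ofReal (1 / (-t))) x := by
  have hnt : 0 < -t := by linarith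
  by_cases hx : x ∈ ball (c t) (2 * Real.sqrt (-t))
  · rw [indicator_of_mem hx, ← ofReal_norm, ← ENNReal.ofReal_pow (norm_nonneg _)]
    refine ENNReal.ofReal_le_ofReal ?_
    have h := norm_swirlTravel_le c ht x
    calc ‖swirlTravel c t x‖ ^ 2 ≤ (1 / Real.sqrt (-t)) ^ 2 := pow_le_pow_left₀ (norm_nonneg _) h 2
      _ = 1 / (-t) := by rw [div_pow, one_pow, Real.sq_sqrt hnt.le]
  · rw [indicator_of_notMem hx]
    have hx' : 2 * Real.sqrt (-t) ≤ ‖x - c t‖ := by rw [mem_ball_iff_norm, not_lt] at hx; exact hx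
    rw [swirlTravel_eq_zero_of c ht hx']
    simp

/-- `|U(t)|³ ≤ (−t)^{−3/2} 𝟙_{B(c(t), 2√(−t))}`. [folklore] -/
theorem enorm_cube_swirlTravel_le (c : ℝ → EuclideanSpace ℝ (Fin 3)) {t : ℝ} (ht : t < 0)
    (x : EuclideanSpace ℝ (Fin 3)) :
    ‖swirlTravel c t x‖ₑ ^ (3 : ℕ) ≤
      (ball (c t) (2 * Real.sqrt (-t))).indicator
        (fun _ => ENNReal.ofReal ((1 / Real.sqrt (-t)) ^ 3)) x := by
  by_cases hx : x ∈ ball (c t) (2 * Real.sqrt (-t))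
  · rw [indicator_of_mem hx, ← ofReal_norm, ← ENNReal.ofReal_pow (norm_nonneg _)]
    exact ENNReal.ofReal_le_ofReal (pow_le_pow_left₀ (norm_nonneg _) (norm_swirlTravel_le c ht x) 3)
  · rw [indicator_of_notMem hx]
    have hx' : 2 * Real.sqrt (-t) ≤ ‖x - c t‖ := by rw [mem_ball_iff_norm, not_lt] at hx; exact hx
    rw [swirlTravel_eq_zero_of c ht hx']
    simp

/-- `|∇U(t)|²_F ≤ 48 L'²/(−t)² 𝟙_{B(c(t), 2√(−t))}` with `L' = 1/2 + 4L`. [folklore] -/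
theorem frob_swirlTravelGradient_le {L : ℝ} (hL0 : 0 ≤ L) (hL : ∀ s, |deriv ParabolicBump.cutoff s| ≤ L)
    (c : ℝ → EuclideanSpace ℝ (Fin 3)) {t : ℝ} (ht : t < 0) (x : EuclideanSpace ℝ (Fin 3)) :
    ENNReal.ofReal (frobeniusNormSq (swirlTravelGradient c t x)) ≤
      (ball (c t) (2 * Real.sqrt (-t))).indicator
        (fun _ => ENNReal.ofReal (48 * (1 / 2 + 4 * L) ^ 2 / (-t) ^ 2)) x := by
  have hnt : 0 < -t := by linarith
  by_cases hx : x ∈ ball (c t) (2 * Real.sqrt (-t))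
  · rw [indicator_of_mem hx]
    refine ENNReal.ofReal_le_ofReal ?_
    have hxn : ‖x - c t‖ ≤ 2 * Real.sqrt (-t) := (mem_ball_iff_norm.1 hx).le
    have hn := norm_swirlGradient_le hL0 hL ht hxn
    calc frobeniusNormSq (swirlTravelGradient c t x) ≤ 3 * ‖swirlGradient t (x - c t)‖ ^ 2 :=
          frobeniusNormSq_le_three_mul_norm_sq' _
      _ ≤ 3 * ((1 / 2 + 4 * L) / (-t)) ^ 2 := by gcongr
      _ ≤ 48 * ((1 / 2 + 4 * L) / (-t)) ^ 2 := by gcongr; norm_num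
      _ = 48 * (1 / 2 + 4 * L) ^ 2 / (-t) ^ 2 := by rw [div_pow]; ring
  · rw [indicator_of_notMem hx]
    have hx' : 2 * Real.sqrt (-t) ≤ ‖x - c t‖ := by rw [mem_ball_iff_norm, not_lt] at hx; exact hx
    rw [swirlTravelGradient, swirlGradient_eq_zero_of ht hx', frobeniusNormSq_zero, ENNReal.ofReal_zero]


/-! ### The Type-I quantity of the travelling swirl on the open lower half-space -/

/-- `(1/r) ∫_{B(x₀,r)} |U(t)|² ≤ 8|B₁|`. [folklore] -/
theorem sliceA_swirlTravel_le (c : ℝ → EuclideanSpace ℝ (Fin 3)) {t r : ℝ} (ht : t < 0) (hr : 0 < r)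
    (x₀ : EuclideanSpace ℝ (Fin 3)) :
    (ENNReal.ofReal r)⁻¹ * ∫⁻ x in ball x₀ r, ‖swirlTravel c t x‖ₑ ^ 2 ≤
      8 * volume (ball (0 : EuclideanSpace ℝ (Fin 3)) 1) :=
  sliceA_le_of_indicator (v := swirlTravel c t) ht hr x₀ (enorm_sq_swirlTravel_le c ht)

/-- `∫_{B(x₀,r)} |U(t)|³ ≤ 8|B₁|`. [folklore] -/
theorem sliceC_swirlTravel_le (c : ℝ → EuclideanSpace ℝ (Fin 3)) {t : ℝ} (ht : t < 0)
    (x₀ : EuclideanSpace ℝ (Fin 3)) (r : ℝ) :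
    ∫⁻ x in ball x₀ r, ‖swirlTravel c t x‖ₑ ^ (3 : ℕ) ≤ 8 * volume (ball (0 : EuclideanSpace ℝ (Fin 3)) 1) :=
  sliceC_le_of_indicator (v := swirlTravel c t) ht x₀ r (enorm_cube_swirlTravel_le c ht)

/-- `∫_{B(x₀,r)} |∇U(t)|² ≤ 384 L'² (−t)^{−1/2} |B₁|`, `L' = 1/2 + 4L`. [folklore] -/
theorem sliceE_swirlTravel_le {L : ℝ} (hL0 : 0 ≤ L) (hL : ∀ s, |deriv ParabolicBump.cutoff s| ≤ L)
    (c : ℝ → EuclideanSpace ℝ (Fin 3)) {t : ℝ} (ht : t < 0) (x₀ : EuclideanSpace ℝ (Fin 3)) (r : ℝ) :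
    ∫⁻ x in ball x₀ r, ENNReal.ofReal (frobeniusNormSq (swirlTravelGradient c t x)) ≤
      ENNReal.ofReal (384 * (1 / 2 + 4 * L) ^ 2 * (0 - t) ^ (-(1 / 2) : ℝ)) *
        volume (ball (0 : EuclideanSpace ℝ (Fin 3)) 1) :=
  sliceE_le_of_indicator (Gs := swirlTravelGradient c t) (L := 1 / 2 + 4 * L) ht x₀ r
    (frob_swirlTravelGradient_le hL0 hL c ht)

/-- The field is a.e.-measurable on the slab (path continuous on `t < 0`). [folklore] -/
theorem aemeasurable_swirlTravel_slab {c : ℝ → EuclideanSpace ℝ (Fin 3)}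
    (hc : ContDiffOn ℝ 0 c (Iio 0)) :
    AEMeasurable (uncurry (swirlTravel c))
      (volume.restrict (Iio (0 : ℝ) ×ˢ (univ : Set (EuclideanSpace ℝ (Fin 3))))) :=
  (contDiffOn_swirlTravel (n := 0) hc).continuousOn.aemeasurable
    (measurableSet_Iio.prod MeasurableSet.univ)

/-- The gradient integrand is a.e.-measurable on the slab (path `C¹` on `t < 0`). [folklore] -/
theorem aemeasurable_frob_swirlTravelGradient_slab {c : ℝ → EuclideanSpace ℝ (Fin 3)}
    (hc : ContDiffOn ℝ 1 c (Iio 0)) :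
    AEMeasurable (fun q : ℝ × EuclideanSpace ℝ (Fin 3) =>
        ENNReal.ofReal (frobeniusNormSq (swirlTravelGradient c q.1 q.2)))
      (volume.restrict (Iio (0 : ℝ) ×ˢ (univ : Set (EuclideanSpace ℝ (Fin 3))))) := by
  have h1 : ContinuousOn (fun q : ℝ × EuclideanSpace ℝ (Fin 3) => fderiv ℝ (swirlTravel c q.1) q.2)
      (Iio (0 : ℝ) ×ˢ univ) :=
    continuousOn_fderiv_slice_of_contDiffOn (contDiffOn_swirlTravel (n := 1) hc) isOpen_Iio.uniqueDiffOn
  have h2 : ContinuousOn (fun q : ℝ × EuclideanSpace ℝ (Fin 3) =>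
      ENNReal.ofReal (frobeniusNormSq (swirlTravelGradient c q.1 q.2))) (Iio (0 : ℝ) ×ˢ univ) := by
    have e : (fun q : ℝ × EuclideanSpace ℝ (Fin 3) =>
        ENNReal.ofReal (frobeniusNormSq (swirlTravelGradient c q.1 q.2))) =
        fun q => ENNReal.ofReal (frobeniusNormSq (fderiv ℝ (swirlTravel c q.1) q.2)) := by
      funext q; rw [fderiv_swirlTravel]
    rw [e]
    exact ENNReal.continuous_ofReal.comp_continuousOn (continuous_frobeniusNormSq₃.comp_continuousOn h1)
  exact h2.aemeasurable (measurableSet_Iio.prod MeasurableSet.univ)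

/-- `A(Q(z,r)) ≤ 8|B₁|` for every admissible cylinder. [folklore] -/
theorem cknAEss_swirlTravel_le (c : ℝ → EuclideanSpace ℝ (Fin 3)) {r : ℝ} (hr : 0 < r)
    {z : ℝ × EuclideanSpace ℝ (Fin 3)}
    (hz : parabolicCylinder r z ⊆ Iio (0 : ℝ) ×ˢ (univ : Set (EuclideanSpace ℝ (Fin 3)))) :
    cknAEss r z (swirlTravel c) ≤ 8 * volume (ball (0 : EuclideanSpace ℝ (Fin 3)) 1) := by
  unfold cknAEss
  refine essSup_le_of_ae_le _ ?_
  filter_upwards [ae_restrict_mem measurableSet_Ioo] with t ht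
  exact sliceA_swirlTravel_le c (neg_of_mem_time hr hz ht) hr z.2

/-- `C(Q(z,r)) ≤ 8|B₁|` for every admissible cylinder. [folklore] -/
theorem cknC_swirlTravel_le {c : ℝ → EuclideanSpace ℝ (Fin 3)} (hc : ContDiffOn ℝ 0 c (Iio 0))
    {r : ℝ} (hr : 0 < r) {z : ℝ × EuclideanSpace ℝ (Fin 3)}
    (hz : parabolicCylinder r z ⊆ Iio (0 : ℝ) ×ˢ (univ : Set (EuclideanSpace ℝ (Fin 3)))) :
    cknC r z (swirlTravel c) ≤ 8 * volume (ball (0 : EuclideanSpace ℝ (Fin 3)) 1) := by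
  set V₁ := volume (ball (0 : EuclideanSpace ℝ (Fin 3)) 1) with hV₁
  unfold cknC
  have hmeas : AEMeasurable (fun q : ℝ × EuclideanSpace ℝ (Fin 3) => ‖swirlTravel c q.1 q.2‖ₑ ^ (3 : ℕ))
      (volume.restrict (parabolicCylinder r z)) :=
    (((aemeasurable_swirlTravel_slab hc).mono_measure (Measure.restrict_mono hz le_rfl)).enorm.pow_const _)
  have h1 : ∫⁻ q in parabolicCylinder r z, ‖swirlTravel c q.1 q.2‖ₑ ^ (3 : ℕ) ≤
      ∫⁻ _ in Ioo (z.1 - r ^ 2) z.1, 8 * V₁ :=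
    lintegral_cylinder_le_of_slice hmeas (by
      filter_upwards [ae_restrict_mem measurableSet_Ioo] with t ht
      exact sliceC_swirlTravel_le c (neg_of_mem_time hr hz ht) z.2 r)
  rw [setLIntegral_const, Real.volume_Ioo, show z.1 - (z.1 - r ^ 2) = r ^ 2 by ring,
    ENNReal.ofReal_pow hr.le] at h1
  have hX0 : ENNReal.ofReal r ^ 2 ≠ 0 := pow_ne_zero _ (ENNReal.ofReal_pos.2 hr).ne'
  have hXt : ENNReal.ofReal r ^ 2 ≠ ⊤ := ENNReal.pow_ne_top ENNReal.ofReal_ne_top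
  calc (ENNReal.ofReal r ^ 2)⁻¹ * ∫⁻ q in parabolicCylinder r z, ‖swirlTravel c q.1 q.2‖ₑ ^ (3 : ℕ)
      ≤ (ENNReal.ofReal r ^ 2)⁻¹ * (8 * V₁ * ENNReal.ofReal r ^ 2) := mul_le_mul' le_rfl h1
    _ = 8 * V₁ := by
        rw [mul_comm (8 * V₁) _, ← mul_assoc, ENNReal.inv_mul_cancel hX0 hXt, one_mul]

/-- `E(Q(z,r)) ≤ 768 L'² |B₁|` for every admissible cylinder, `L' = 1/2 + 4L`. [folklore] -/
theorem cknE_swirlTravel_le {L : ℝ} (hL0 : 0 ≤ L) (hL : ∀ s, |deriv ParabolicBump.cutoff s| ≤ L)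
    {c : ℝ → EuclideanSpace ℝ (Fin 3)} (hc : ContDiffOn ℝ 1 c (Iio 0)) {r : ℝ} (hr : 0 < r)
    {z : ℝ × EuclideanSpace ℝ (Fin 3)}
    (hz : parabolicCylinder r z ⊆ Iio (0 : ℝ) ×ˢ (univ : Set (EuclideanSpace ℝ (Fin 3)))) :
    cknE r z (swirlTravelGradient c) ≤
      ENNReal.ofReal (768 * (1 / 2 + 4 * L) ^ 2) * volume (ball (0 : EuclideanSpace ℝ (Fin 3)) 1) := by
  set V₁ := volume (ball (0 : EuclideanSpace ℝ (Fin 3)) 1) with hV₁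
  set L' : ℝ := 1 / 2 + 4 * L with hL'
  have hz1 : z.1 ≤ 0 := fst_nonpos_of_subset hr hz
  unfold cknE
  have hmeas : AEMeasurable (fun q : ℝ × EuclideanSpace ℝ (Fin 3) =>
      ENNReal.ofReal (frobeniusNormSq (swirlTravelGradient c q.1 q.2)))
      (volume.restrict (parabolicCylinder r z)) :=
    (aemeasurable_frob_swirlTravelGradient_slab hc).mono_measure (Measure.restrict_mono hz le_rfl)
  have h1 : ∫⁻ q in parabolicCylinder r z,
        ENNReal.ofReal (frobeniusNormSq (swirlTravelGradient c q.1 q.2)) ≤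
      ∫⁻ t in Ioo (z.1 - r ^ 2) z.1,
        ENNReal.ofReal (384 * L' ^ 2) * V₁ * ENNReal.ofReal ((0 - t) ^ (-(1 / 2) : ℝ)) :=
    lintegral_cylinder_le_of_slice hmeas (by
      filter_upwards [ae_restrict_mem measurableSet_Ioo] with t ht
      have ht0 : t < 0 := neg_of_mem_time hr hz ht
      refine (sliceE_swirlTravel_le hL0 hL c ht0 z.2 r).trans (le_of_eq ?_)
      rw [← hL', ENNReal.ofReal_mul (by positivity : (0 : ℝ) ≤ 384 * L' ^ 2)]
      ring)
  have h2 : ∫⁻ t in Ioo (z.1 - r ^ 2) z.1,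
        ENNReal.ofReal (384 * L' ^ 2) * V₁ * ENNReal.ofReal ((0 - t) ^ (-(1 / 2) : ℝ)) ≤
      ENNReal.ofReal (384 * L' ^ 2) * V₁ * ENNReal.ofReal (2 * r) := by
    rw [lintegral_const_mul' _ _ (ENNReal.mul_ne_top ENNReal.ofReal_ne_top measure_ball_lt_top.ne)]
    exact mul_le_mul' le_rfl (lintegral_invSqrt_time_le hz1 hr)
  calc (ENNReal.ofReal r)⁻¹ *
        ∫⁻ q in parabolicCylinder r z, ENNReal.ofReal (frobeniusNormSq (swirlTravelGradient c q.1 q.2))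
      ≤ (ENNReal.ofReal r)⁻¹ * (ENNReal.ofReal (384 * L' ^ 2) * V₁ * ENNReal.ofReal (2 * r)) :=
        mul_le_mul' le_rfl (h1.trans h2)
    _ = ENNReal.ofReal (768 * L' ^ 2) * V₁ := by
        rw [← ENNReal.ofReal_inv_of_pos hr]
        have e1 : ENNReal.ofReal r⁻¹ * (ENNReal.ofReal (384 * L' ^ 2) * V₁ * ENNReal.ofReal (2 * r)) =
            (ENNReal.ofReal r⁻¹ * ENNReal.ofReal (384 * L' ^ 2) * ENNReal.ofReal (2 * r)) * V₁ := by
          ring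
        have e2 : ENNReal.ofReal r⁻¹ * ENNReal.ofReal (384 * L' ^ 2) * ENNReal.ofReal (2 * r) =
            ENNReal.ofReal (r⁻¹ * (384 * L' ^ 2) * (2 * r)) := by
          rw [ENNReal.ofReal_mul (by positivity : (0 : ℝ) ≤ r⁻¹ * (384 * L' ^ 2)),
            ENNReal.ofReal_mul (by positivity : (0 : ℝ) ≤ r⁻¹)]
        have e3 : r⁻¹ * (384 * L' ^ 2) * (2 * r) = 768 * L' ^ 2 := by
          field_simp
          ring
        rw [e1, e2, e3]

/-- **(I) `𝐈(ℝ³ × ℝ₋) ≤ M < ⊤` for the travelling swirl** (pressure `0`; path `C¹` on `t < 0`). [folklore] -/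
theorem typeIBound_swirlTravel_le {c : ℝ → EuclideanSpace ℝ (Fin 3)} (hc : ContDiffOn ℝ 1 c (Iio 0)) :
    ∃ M : ℝ≥0, typeIBound (Iio (0 : ℝ) ×ˢ (univ : Set (EuclideanSpace ℝ (Fin 3))))
      (swirlTravel c) 0 (swirlTravelGradient c) ≤ M := by
  obtain ⟨L, hL0, hL⟩ := ParabolicBump.exists_bound_deriv_cutoff
  have hc0 : ContDiffOn ℝ 0 c (Iio 0) := hc.of_le zero_le_one
  set V₁ := volume (ball (0 : EuclideanSpace ℝ (Fin 3)) 1) with hV₁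
  have hV : V₁ < ⊤ := measure_ball_lt_top
  set B : ℝ≥0∞ := 8 * V₁ + 8 * V₁ + 0 + ENNReal.ofReal (768 * (1 / 2 + 4 * L) ^ 2) * V₁ with hB
  have hbound : typeIBound (Iio (0 : ℝ) ×ˢ (univ : Set (EuclideanSpace ℝ (Fin 3))))
      (swirlTravel c) 0 (swirlTravelGradient c) ≤ B := by
    refine typeIBound_le_iff.2 fun r hr z hz => ?_
    unfold abScaledSum
    exact add_le_add (add_le_add (add_le_add (cknAEss_swirlTravel_le c hr hz)
      (cknC_swirlTravel_le hc0 hr hz)) (cknDOsc_zero r z).le) (cknE_swirlTravel_le hL0 hL hc hr hz)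
  have hBtop : B ≠ ⊤ := by
    have h8 : (8 : ℝ≥0∞) * V₁ < ⊤ := ENNReal.mul_lt_top (by simp) hV
    exact (ENNReal.add_lt_top.2 ⟨ENNReal.add_lt_top.2 ⟨ENNReal.add_lt_top.2 ⟨h8, h8⟩, by simp⟩,
      ENNReal.mul_lt_top ENNReal.ofReal_lt_top hV⟩).ne
  refine ⟨B.toNNReal, ?_⟩
  rw [ENNReal.coe_toNNReal hBtop]
  exact hbound

/-- Hence **(I)**: `𝐈(Q(a)) ≤ M` for every cylinder at the origin (one `M` for all `a`). [folklore] -/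
theorem typeIBound_swirlTravel_cylinder_le {c : ℝ → EuclideanSpace ℝ (Fin 3)}
    (hc : ContDiffOn ℝ 1 c (Iio 0)) :
    ∃ M : ℝ≥0, ∀ a : ℝ, typeIBound (parabolicCylinder a (0 : ℝ × EuclideanSpace ℝ (Fin 3)))
      (swirlTravel c) 0 (swirlTravelGradient c) ≤ M := by
  obtain ⟨M, hM⟩ := typeIBound_swirlTravel_le hc
  exact ⟨M, fun a => (typeIBound_mono (parabolicCylinder_subset_slab a)).trans hM⟩


end Summit.NavierStokesRegularity.NavierStokesRegularity.Theorems.TypeITraceScarL3.Negative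

end
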